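import Summits.BirchSwinnertonDyer.BirchSwinnertonDyer.Theorems.KolyvaginDepthDoorDepthTableRowKitSecondSign
import Summits.BirchSwinnertonDyer.BirchSwinnertonDyer.Theorems.KolyvaginDepthDoorDepthTableGlobalMinimal
import Summits.BirchSwinnertonDyer.BirchSwinnertonDyer.Theorems.KolyvaginDepthDoorDepthTableOddPrimeKit
import Summits.BirchSwinnertonDyer.BirchSwinnertonDyer.Theorems.Rank2ObservatoryKernelPrimes
import Summits.BirchSwinnertonDyer.BirchSwinnertonDyer.Theorems.Rank1ResidualIntModelReduction
import Summits.BirchSwinnertonDyer.Rank1Residual.Additive.PointCountEulerNat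
import Literature.NumberTheory.EllipticCurves.ComplexMultiplicationNotSemistable
import Literature.NumberTheory.EllipticCurves.RationalPointInfiniteOrderCriteria
import Mathlib.Tactic.NormNum.LegendreSymbol
import HarnessLib

/-!
# Route `KolyvaginDepthDoor` — DEPTH-TABLE ROWS ON THE SECOND SIGN, part 2: `43a1` `(5, -71, 269)`, `43a1` `(5, -191, 179)`
# (crux `KolyvaginDepthSupply`, stmt-BirchSwinnertonDyer-21765)

Helper file (`--supports stmt-BirchSwinnertonDyer-21765 --as helper`); it closes nothing and BSD is
not proved by it.

The route's depth table (g2–g9) has rows only on the crux's FIRST rank clause (`ν + 1 = rank E(ℚ)`,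
the 18 rank-2 and 9 rank-3 Cremona curves). This file fills rows on the SECOND clause
`ν = rank E(ℚ) = rank E^{(d_K)}(ℚ) − 1` with `ν = 1`: a RANK-ONE curve `E` and a Heegner field
`K = ℚ(√D)` for `N_E` whose quadratic twist `E^{(D)}` — a RANK-TWO elliptic curve over `ℚ` of conductor
`N_E·D²`, out of reach of every first-sign row through `K` (no Heegner hypothesis for `N_E D²`) — has
two independent rational points. Everything except the bit is decided in the kernel: `E` globally
minimal, non-CM (a multiplicative prime), `ρ̄_{E,p^m}` onto for all `m` (Mazur 6.3 witness + Serre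
Prop. 21 + a transvection), `p` good ordinary, the Heegner condition for `(Δ(E₀), D)`, the Kolyvagin
prime `ℓ` (`(D/ℓ) = −1`, `p ∣ ℓ + 1`, `p ∣ a_ℓ`), `1 ≤ rank_ℤ E(ℚ)` (a rational point with a denominator,
AEC VII.3.4) and `2 ≤ rank_ℤ E^{(D)}(ℚ)` (the tree's rational kernel certificate
`Rank2Observatory.two_le_mordellWeilRank_of_ratCert` on the twist model `[0, D b₂, 0, 8D²b₄, 16D³b₆]`
of the kit `…RowKitSecondSign`: two points found by a naive search, their chord, an odd torsion
annihilator from kernel point counts, doubling witnesses). Each row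
`SecondSign.C<label>.depthRow_<p>_neg<|D|>_<ℓ>_secondSign` takes ANY frame `(Dt, β, ι)` and ANY single
Kolyvagin–Heegner datum `d` of conductor `ℓ`, the ONE named input (γ) =
`GrossLMS1991.prop37_2_frobeniusCongruence` (Gross 1991 Prop. 3.7 (2); cite-only), and concludes from the
bit `d.kolyvaginClass _ 1 ≠ 0`: `corank_{ℤ_p} Ш(E)[p^∞] = 0`, `rank_ℤ E(ℚ) = 1`,
`corank_{ℤ_p} Ш(E^{(D)})[p^∞] = 0`, `rank_ℤ E^{(D)}(ℚ) = 2`, `E(ℚ)[p] = 0`, `Ш(E/ℚ)[p] = 0`,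
`#Sel^(p)(E/ℚ) = p`, `Ш(E^{(D)}/ℚ)[p] = 0`, `#Sel^(p)(E^{(D)}/ℚ) = p²`. CONDITIONAL on (γ) and the bit;
per-curve; BSD is not proved by it.

| curve | `Δ` | `p` (`a_p`) | `d_K` | `ℓ` (`a_ℓ`) | twist model | `P₁`, `P₂` on the twist model |
|---|---|---|---|---|---|---|
| `43a1` = `[0,1,1,0,0]` | `-43` | `5` (`-4`) | `-71` | `269` (`-25`) | `[0,-284,0,0,-5726576]` | `(41180, -8327732)`, `(852, -20164)` |
| `43a1` = `[0,1,1,0,0]` | `-43` | `5` (`-4`) | `-191` | `179` (`20`) | `[0,-764,0,0,-111485936]` | `(3056, -145924)`, `(591336/289, -356200484/4913)` |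

References: [Kolyvagin1991MathAnn] Thm. 2.3; [GrossLMS1991] Prop. 3.7 (2), §5 (5.1), Prop. 6.2 (1);
[McCallumLMS1991] §§2–5; [Serre1972] §5.4 Prop. 21; [Mazur1978] §6 Prop. 6.3 (1);
[CremonaAlgorithms1997] Table 1, §2.4, §3.5; [SilvermanAEC2009] III.2.3, VII.3.1(b), VII.3.4, VIII.6.7,
X.5 Cor. 5.4; [Marcus1977] Ch. 3 Thm. 25; [JetchevLauterStein2009] §3.6 (arXiv:0707.0032).
-/

set_option linter.dupNamespace false

noncomputable section

open scoped Classical NumberField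

namespace Summit.BirchSwinnertonDyer.BirchSwinnertonDyer.Theorems.KolyvaginDepthDoor

open Literature.NumberTheory.EllipticCurves Literature.NumberTheory.EllipticCurves.ModularForms
  WeierstrassCurve
open Summit.BirchSwinnertonDyer.BirchSwinnertonDyer.Rank2Observatory
open Summit.BirchSwinnertonDyer.BirchSwinnertonDyer.Rank1Residual
open Summit.BirchSwinnertonDyer.Rank1Residual.Additive

namespace SecondSign

/-! ## Curve `43a1` = `[0,1,1,0,0]` (`Δ = -43`), rank one -/

namespace C43a1

/-- `43a1` = `[0,1,1,0,0]` is an elliptic curve over `ℚ` (`Δ = -43 ≠ 0`, kernel-checked).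
[cite: CremonaAlgorithms1997, Table 1 (43a1)] -/
theorem isElliptic : ((⟨0, 1, 1, 0, 0⟩ : WeierstrassCurve ℤ).map (Int.castRingHom ℚ)).IsElliptic := by
  rw [WeierstrassCurve.isElliptic_iff, WeierstrassCurve.map_Δ, isUnit_iff_ne_zero, eq_intCast,
    Int.cast_ne_zero]
  decide +kernel

/-- **`43a1` = `[0,1,1,0,0]` is a global minimal equation over `ℚ`** (`|Δ| = 43 < 3¹²`, `2¹² ∤ Δ`;
`isGloballyMinimal_map_int_of_natAbs_Δ_lt`, kernel-checked). [cite: CremonaAlgorithms1997, Table 1 (43a1)]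
[cite: SilvermanAEC2009, VII.1 Remark 1.1 and VIII.8] -/
theorem isGloballyMinimal : ((⟨0, 1, 1, 0, 0⟩ : WeierstrassCurve ℤ).map (Int.castRingHom ℚ)).IsGloballyMinimal :=
  isGloballyMinimal_map_int_of_natAbs_Δ_lt _ (by decide +kernel) (by decide +kernel) (by decide +kernel)

/-- The integral model of `43a1` is `[0,1,1,0,0]`. [cite: CremonaAlgorithms1997, Table 1 (43a1)] -/
theorem intModel :
    haveI := isGloballyMinimal;
    integralModelInt ((⟨0, 1, 1, 0, 0⟩ : WeierstrassCurve ℤ).map (Int.castRingHom ℚ)) = ⟨0, 1, 1, 0, 0⟩ := by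
  haveI := isGloballyMinimal
  exact IntModel.integralModelInt_eq_of_map_eq _ rfl

/-- `#Ẽ(𝔽_3) = 6`, `a_3 = -2` for `43a1`, kernel-decided (`ℕ`-arithmetic Euler count
`PointCountNat.natCard_point_map_eq`). [cite: CremonaAlgorithms1997, Table 1 (43a1) and §2.4] -/
theorem card_3 :
    Nat.card (((⟨0, 1, 1, 0, 0⟩ : WeierstrassCurve ℤ).map (Int.castRingHom (ZMod 3))).toAffine.Point) = 6 := by
  rw [PointCountNat.natCard_point_map_eq (hℓ := ⟨by norm_num⟩) (by norm_num) 0 1 1 0 0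
    (by decide +kernel)]
  decide +kernel

/-- `#Ẽ(𝔽_5) = 10`, `a_5 = -4` for `43a1`, kernel-decided (`ℕ`-arithmetic Euler count
`PointCountNat.natCard_point_map_eq`). [cite: CremonaAlgorithms1997, Table 1 (43a1) and §2.4] -/
theorem card_5 :
    Nat.card (((⟨0, 1, 1, 0, 0⟩ : WeierstrassCurve ℤ).map (Int.castRingHom (ZMod 5))).toAffine.Point) = 10 := by
  rw [PointCountNat.natCard_point_map_eq (hℓ := ⟨by norm_num⟩) (by norm_num) 0 1 1 0 0
    (by decide +kernel)]
  decide +kernel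

/-- `#Ẽ(𝔽_179) = 160`, `a_179 = 20` for `43a1`, kernel-decided (`ℕ`-arithmetic Euler count
`PointCountNat.natCard_point_map_eq`). [cite: CremonaAlgorithms1997, Table 1 (43a1) and §2.4] -/
theorem card_179 :
    Nat.card (((⟨0, 1, 1, 0, 0⟩ : WeierstrassCurve ℤ).map (Int.castRingHom (ZMod 179))).toAffine.Point) = 160 := by
  rw [PointCountNat.natCard_point_map_eq (hℓ := ⟨by norm_num⟩) (by norm_num) 0 1 1 0 0
    (by decide +kernel)]
  decide +kernel

/-- `#Ẽ(𝔽_269) = 295`, `a_269 = -25` for `43a1`, kernel-decided (`ℕ`-arithmetic Euler count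
`PointCountNat.natCard_point_map_eq`). [cite: CremonaAlgorithms1997, Table 1 (43a1) and §2.4] -/
theorem card_269 :
    Nat.card (((⟨0, 1, 1, 0, 0⟩ : WeierstrassCurve ℤ).map (Int.castRingHom (ZMod 269))).toAffine.Point) = 295 := by
  rw [PointCountNat.natCard_point_map_eq (hℓ := ⟨by norm_num⟩) (by norm_num) 0 1 1 0 0
    (by decide +kernel)]
  decide +kernel

/-- **`5 ∈ B(43a1)`: `ρ̄_{E,5^m}` is onto for every `m`** (unconditional): semistable
(`gcd(c₄, Δ) = 1`), `X² − a_3 X + 3` with `a_3 = -2` root-free mod `5` (`E[5]` irreducible, Mazur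
6.3; onto, Serre Prop. 21), and the multiplicative prime `43` with `43^1 ∥ Δ`, `5 ∤ 1` (a transvection
lifts the image to `GL₂(ℤ/5^m)`; `hasSurjectiveModNGaloisRep_pow_of_intModel_certificate`).
[cite: Serre1972, §5.4 Prop. 21] [cite: Mazur1978, §6 Prop. 6.3 (1)] [cite: SerreAbelianLadic1968, Ch. IV §3.4] -/
theorem hasSurjectiveModNGaloisRep_pow_5 (m : ℕ) :
    ((⟨0, 1, 1, 0, 0⟩ : WeierstrassCurve ℤ).map (Int.castRingHom ℚ)).HasSurjectiveModNGaloisRep (5 ^ m : ℕ) := by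
  have hn : ∀ t : ZMod 5, t ^ 2 - (((3 : ℕ) : ℤ) + 1 - (6 : ℕ) : ℤ) * t + ((3 : ℕ) : ZMod 5) ≠ 0 := by
    decide +kernel
  haveI := Fact.mk (by norm_num : Nat.Prime 5)
  haveI := Fact.mk (by norm_num : Nat.Prime 3)
  haveI := isElliptic
  haveI := isGloballyMinimal
  exact hasSurjectiveModNGaloisRep_pow_of_intModel_certificate intModel
    (by rw [Int.isCoprime_iff_gcd_eq_one]; decide +kernel) 5 3 (by norm_num) (by decide +kernel)
    (n := 6) card_3 hn 43 (by norm_num) (by norm_num) (by decide +kernel) (by decide +kernel)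
    (e := 1) (by decide +kernel) (by decide +kernel) (by decide +kernel) m

/-- **`5` is a prime of good ordinary reduction for `43a1`** (`5 ∤ Δ`, `a_5 = -4`) — the crux's
conditions on the witness prime. [cite: CremonaAlgorithms1997, Table 1 (43a1)] -/
theorem goodOrdinary_5 :
    haveI := Fact.mk (by norm_num : Nat.Prime 5);
    haveI := isGloballyMinimal;
    ((⟨0, 1, 1, 0, 0⟩ : WeierstrassCurve ℤ).map (Int.castRingHom ℚ)).HasGoodReductionAtPrime 5 ∧ ¬ ((5 : ℕ) : ℤ) ∣ ((⟨0, 1, 1, 0, 0⟩ : WeierstrassCurve ℤ).map (Int.castRingHom ℚ)).frobeniusTrace 5 := by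
  haveI := Fact.mk (by norm_num : Nat.Prime 5)
  haveI := isGloballyMinimal
  exact goodOrdinary_of_intModel_certificate intModel 5 (by decide +kernel) (n := 10) card_5
    (by decide +kernel)

/-- **`43a1` is not CM** (unconditional): multiplicative reduction at `43` (`43 ∣ Δ = -43`,
`43 ∤ c₄ = 16`), while a CM curve over `ℚ` has no multiplicative prime (integral `j`).
[cite: SilvermanATAEC1994, Thm. II.6.4 (PDF p. 148)] [cite: CremonaAlgorithms1997, Table 1 (43a1)] -/
theorem not_hasCM :
    haveI := isElliptic;
    ¬ ((⟨0, 1, 1, 0, 0⟩ : WeierstrassCurve ℤ).map (Int.castRingHom ℚ)).HasCM := by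
  haveI := isElliptic
  haveI := isGloballyMinimal
  haveI := Fact.mk (by norm_num : Nat.Prime 43)
  intro hCM
  exact not_hasMultiplicativeReductionAtPrime_of_hasCM _ hCM 43
    (IntModel.hasMultiplicativeReductionAtPrime_of_intModel intModel 43 (by decide +kernel)
      (by decide +kernel))

/-- **`1 ≤ rank_ℤ E(ℚ)` for `43a1` IN THE KERNEL** — kind-`NL` certificate: the rational point
`3·(-1, 0) = (-2/9, 1/27)` has `3 ∣ den(x)`, hence infinite order (AEC VII.3.4; tree
`one_le_mordellWeilRank_of_dvd_den`). [cite: SilvermanAEC2009, VII.3.4 and Thm. VIII.6.7]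
[cite: CremonaAlgorithms1997, Table 1 (43a1)] -/
theorem one_le_rank : 1 ≤ ((⟨0, 1, 1, 0, 0⟩ : WeierstrassCurve ℤ).map (Int.castRingHom ℚ)).mordellWeilRank := by
  haveI := isElliptic
  haveI := isGloballyMinimal
  haveI : Fact (Nat.Prime 3) := ⟨by norm_num⟩
  have hP : ((⟨0, 1, 1, 0, 0⟩ : WeierstrassCurve ℤ).map (Int.castRingHom ℚ)).toAffine.Nonsingular ((-2 : ℚ) / 9) ((1 : ℚ) / 27) :=
    WeierstrassCurve.Affine.equation_iff_nonsingular.mp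
      ((WeierstrassCurve.Affine.equation_iff _ _).mpr (by norm_num [WeierstrassCurve.map]))
  exact one_le_mordellWeilRank_of_dvd_den _ 3 (by norm_num) hP (by decide +kernel)


/-! ### Row `43a1`, `(p, d_K, ℓ) = (5, -71, 269)`: the twist `E^{(-71)}` has rank two -/

/-- **Heegner data `d_K = -71` for `43a1`**: every prime of `Δ = -43` (hence of `N_E`) splits in a
quadratic field of discriminant `-71` (Kronecker symbols `= 1`). [cite: Marcus1977, Ch. 3 Thm. 25]
[cite: GrossLMS1991, §1] -/
theorem heegner_neg71 : ∀ q : ℕ, q.Prime → (q : ℤ) ∣ (⟨0, 1, 1, 0, 0⟩ : WeierstrassCurve ℤ).Δ →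
    (q = 2 → (-71 : ℤ) % 8 = 1) ∧ (q ≠ 2 → jacobiSym (-71) q = 1) :=
  forall_prime_dvd_of_natAbs_eq_pow (a := 43) (i := 1) (by decide +kernel) (by norm_num)
    ⟨by norm_num, by norm_num⟩

/-- The twist model of the kit `…RowKitSecondSign` for `(43a1, D = -71)`:
`[0, D b₂, 0, 8 D² b₄, 16 D³ b₆] = ⟨0, -284, 0, 0, -5726576⟩` (`ℚ`-isomorphic to `E^{(-71)}`, `u = 1/2`).
[cite: SilvermanAEC2009, X.5 Cor. 5.4] -/
theorem twistModel_neg71 :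
    (⟨0, (-71) * (⟨0, 1, 1, 0, 0⟩ : WeierstrassCurve ℤ).b₂, 0, 8 * (-71) ^ 2 * (⟨0, 1, 1, 0, 0⟩ : WeierstrassCurve ℤ).b₄, 16 * (-71) ^ 3 * (⟨0, 1, 1, 0, 0⟩ : WeierstrassCurve ℤ).b₆⟩ : WeierstrassCurve ℤ) =
      ⟨0, -284, 0, 0, -5726576⟩ := by
  ext <;> decide +kernel

/-- Killers for the twist model `⟨0, -284, 0, 0, -5726576⟩` of `E^{(-71)}` from the kernel counts
`(q, #Ṽ(𝔽_q)) ∈ [(3, 6), (23, 23)]`. [cite: SilvermanAEC2009, Prop. VII.3.1(b)] -/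
theorem killers_neg71 : ∀ ℓN ∈ [((3 : ℕ), (6 : ℕ)), (23, 23)], ℓN.1.Prime ∧
    ∀ (x : ((⟨0, -284, 0, 0, -5726576⟩ : WeierstrassCurve ℤ).map (Int.castRingHom ℚ)).toAffine.Point)
      (n : ℕ), ¬ ℓN.1 ∣ n → n • x = 0 → ℓN.2 • x = 0 :=
  killers_cons _ (q := 3) (N := 6) (by decide +kernel) (by decide +kernel)
    (killers_cons _ (q := 23) (N := 23) (by decide +kernel) (by decide +kernel)
    (killers_nil _))

/-- **`2 ≤ rank_ℤ E^{(-71)}(ℚ)` for `E = 43a1` IN THE KERNEL**, on the twist model `⟨0, -284, 0, 0, -5726576⟩`: rational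
kernel certificate `Rank2Observatory.two_le_mordellWeilRank_of_ratCert` with the points
`P₁ = (41180, -8327732)`, `P₂ = (852, -20164)` (found by a naive search on `d·η² = f(x)`), their chord
`P₁ + P₂ = (688, -13620)`, odd torsion annihilator `t = 1` from the counts at `q = 3, 23`, and doubling
witnesses at `q = 5, 3, 3` (residues `(0,3)`, `(0,2)`, `(1,0)`). Hence `P₁, P₂` are
`ℤ`-independent. [cite: SilvermanAEC2009, III.2.3, Prop. VII.3.1(b) and Thm. VIII.6.7]
[cite: CremonaAlgorithms1997, §3.5] -/
theorem two_le_rank_twist_neg71 :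
    2 ≤ ((⟨0, -284, 0, 0, -5726576⟩ : WeierstrassCurve ℤ).map (Int.castRingHom ℚ)).mordellWeilRank :=
  two_le_mordellWeilRank_of_ratCert _ (x₁ := 41180) (y₁ := -8327732) (x₂ := 852) (y₂ := -20164)
    (x₃ := 688) (y₃ := -13620) (by decide +kernel) (by decide +kernel)
    (by decide +kernel) (by decide +kernel) (t := 1) (by decide) killers_neg71 (by decide +kernel)
    5 3 3 (by decide +kernel) (by decide +kernel) (by decide +kernel) (by decide +kernel)
    (by decide +kernel) (by decide +kernel) 0 3 0 2 1 0 (by decide +kernel)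
    (by decide +kernel) (by decide +kernel) (by decide +kernel) (by decide +kernel)
    (by decide +kernel)

/-- **SECOND-SIGN DEPTH-TABLE ROW `43a1`, `(p, d_K, ℓ) = (5, -71, 269)`, ON PRINT-STANDARD INPUTS.**
For `E = 43a1` (rank one), ANY imaginary quadratic `K` with `d_K = -71` (Heegner for `N_E`; the twist
`E^{(-71)}` has two independent rational points, certified in the kernel), any frame `(Dt, β, ι)` and
ANY single Kolyvagin–Heegner datum `d` of conductor `269` (a Kolyvagin prime: `(-71/269) = −1`,
`5 ∣ 269 + 1`, `5 ∣ a_269 = -25`), granted the ONE Literature fact (γ) =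
`GrossLMS1991.prop37_2_frobeniusCongruence` (Gross 1991 Prop. 3.7 (2); cite-only): IF
`d.kolyvaginClass _ 1 ≠ 0` (the row's bit), THEN `corank_{ℤ_5} Ш(E)[5^∞] = 0`, `rank_ℤ E(ℚ) = 1`,
`corank_{ℤ_5} Ш(E^{(-71)})[5^∞] = 0`, `rank_ℤ E^{(-71)}(ℚ) = 2`, `E(ℚ)[5] = 0`, `Ш(E/ℚ)[5] = 0`,
`#Sel^(5)(E/ℚ) = 5`, `Ш(E^{(-71)}/ℚ)[5] = 0` and `#Sel^(5)(E^{(-71)}/ℚ) = 5²` — the crux's SECOND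
rank clause `ν = rank E(ℚ) = rank E^{(d_K)}(ℚ) − 1` at this curve, and `Ш[5] = 0` for the RANK-TWO
curve `E^{(-71)}` (conductor `N_E·71²`), which no first-sign row reaches through `K`. Side conditions:
`ρ̄_{E,5^m}` onto (`hasSurjectiveModNGaloisRep_pow_5`), non-CM, Heegner, Kolyvagin prime
(`card_269`), (KN_5) from `Δ(E₀) = -43` (`decide`-able table), `1 ≤ rank` (`one_le_rank`),
`2 ≤ rank E^{(-71)}` (`two_le_rank_twist_neg71`) — all kernel theorems. CONDITIONAL on (γ) and the
bit; per-curve; BSD is not proved by it. [cite: Kolyvagin1991MathAnn, Thm. 2.3]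
[cite: GrossLMS1991, Prop. 3.7 (2), §5 (5.1), Prop. 6.2 (1)] [cite: McCallumLMS1991, §§2–5]
[cite: JetchevLauterStein2009, §3.6 (arXiv:0707.0032)] -/
theorem depthRow_5_neg71_269_secondSign
    (h372 : GrossLMS1991.prop37_2_frobeniusCongruence)
    (K : Type) [Field K] [NumberField K] (hK : IsImaginaryQuadratic K)
    (hD : NumberField.discr K = -71) :
    haveI := isElliptic;
    haveI := isGloballyMinimal;
    haveI : NeZero (((⟨0, 1, 1, 0, 0⟩ : WeierstrassCurve ℤ).map (Int.castRingHom ℚ)).conductorNorm ℤ) := neZero_conductorNorm_of_isElliptic _;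
    ∀ (Dt : ModularParametrizationData ((⟨0, 1, 1, 0, 0⟩ : WeierstrassCurve ℤ).map (Int.castRingHom ℚ)) (((⟨0, 1, 1, 0, 0⟩ : WeierstrassCurve ℤ).map (Int.castRingHom ℚ)).conductorNorm ℤ)) (β : ℤ) (ι : K →+* ℂ)
      (d : KolyvaginHeegnerData Dt β ι 269),
    d.kolyvaginClass (p := 5) (by norm_num) 1 ≠ 0 →
    ((⟨0, 1, 1, 0, 0⟩ : WeierstrassCurve ℤ).map (Int.castRingHom ℚ)).shaCorank 5 = 0 ∧ ((⟨0, 1, 1, 0, 0⟩ : WeierstrassCurve ℤ).map (Int.castRingHom ℚ)).mordellWeilRank = 1 ∧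
      (((⟨0, 1, 1, 0, 0⟩ : WeierstrassCurve ℤ).map (Int.castRingHom ℚ)).quadraticTwist ((-71 : ℤ) : ℚ)).shaCorank 5 = 0 ∧
      (((⟨0, 1, 1, 0, 0⟩ : WeierstrassCurve ℤ).map (Int.castRingHom ℚ)).quadraticTwist ((-71 : ℤ) : ℚ)).mordellWeilRank = 2 ∧
      (∀ P : ((⟨0, 1, 1, 0, 0⟩ : WeierstrassCurve ℤ).map (Int.castRingHom ℚ)).toAffine.Point, 5 • P = 0 → P = 0) ∧
      (∀ x ∈ ((⟨0, 1, 1, 0, 0⟩ : WeierstrassCurve ℤ).map (Int.castRingHom ℚ)).sha, 5 • x = 0 → x = 0) ∧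
      Nat.card ↥(selmerGroup ((⟨0, 1, 1, 0, 0⟩ : WeierstrassCurve ℤ).map (Int.castRingHom ℚ)) ((5 : ℕ) : ℤ)) = 5 ∧
      (∀ x ∈ (((⟨0, 1, 1, 0, 0⟩ : WeierstrassCurve ℤ).map (Int.castRingHom ℚ)).quadraticTwist ((-71 : ℤ) : ℚ)).sha, 5 • x = 0 → x = 0) ∧
      Nat.card ↥(selmerGroup (((⟨0, 1, 1, 0, 0⟩ : WeierstrassCurve ℤ).map (Int.castRingHom ℚ)).quadraticTwist ((-71 : ℤ) : ℚ)) ((5 : ℕ) : ℤ)) = 5 ^ 2 := by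
  haveI := isElliptic
  haveI := isGloballyMinimal
  haveI : NeZero (((⟨0, 1, 1, 0, 0⟩ : WeierstrassCurve ℤ).map (Int.castRingHom ℚ)).conductorNorm ℤ) := neZero_conductorNorm_of_isElliptic _
  intro Dt β ι d hne
  haveI := Fact.mk (by norm_num : Nat.Prime 5)
  exact depthRowSecondSign_print_of_datum_of_intModel_certificate intModel h372 not_hasCM one_le_rank
    5 (by norm_num) hasSurjectiveModNGaloisRep_pow_5 K hK hD (by norm_num) (by norm_num)
    twistModel_neg71 two_le_rank_twist_neg71 heegner_neg71 269 (by norm_num) (by norm_num)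
    (by decide +kernel) (by norm_num) (by norm_num) (by norm_num) (by norm_num) (n := 295) card_269
    (by norm_num) (Δ₀ := -43) (by decide +kernel) (B := 11) (by decide +kernel) (by decide +kernel)
    (fun _ _ ↦ Or.inl (by norm_num)) Dt β ι d hne


/-! ### Row `43a1`, `(p, d_K, ℓ) = (5, -191, 179)`: the twist `E^{(-191)}` has rank two -/

/-- **Heegner data `d_K = -191` for `43a1`**: every prime of `Δ = -43` (hence of `N_E`) splits in a
quadratic field of discriminant `-191` (Kronecker symbols `= 1`). [cite: Marcus1977, Ch. 3 Thm. 25]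
[cite: GrossLMS1991, §1] -/
theorem heegner_neg191 : ∀ q : ℕ, q.Prime → (q : ℤ) ∣ (⟨0, 1, 1, 0, 0⟩ : WeierstrassCurve ℤ).Δ →
    (q = 2 → (-191 : ℤ) % 8 = 1) ∧ (q ≠ 2 → jacobiSym (-191) q = 1) :=
  forall_prime_dvd_of_natAbs_eq_pow (a := 43) (i := 1) (by decide +kernel) (by norm_num)
    ⟨by norm_num, by norm_num⟩

/-- The twist model of the kit `…RowKitSecondSign` for `(43a1, D = -191)`:
`[0, D b₂, 0, 8 D² b₄, 16 D³ b₆] = ⟨0, -764, 0, 0, -111485936⟩` (`ℚ`-isomorphic to `E^{(-191)}`, `u = 1/2`).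
[cite: SilvermanAEC2009, X.5 Cor. 5.4] -/
theorem twistModel_neg191 :
    (⟨0, (-191) * (⟨0, 1, 1, 0, 0⟩ : WeierstrassCurve ℤ).b₂, 0, 8 * (-191) ^ 2 * (⟨0, 1, 1, 0, 0⟩ : WeierstrassCurve ℤ).b₄, 16 * (-191) ^ 3 * (⟨0, 1, 1, 0, 0⟩ : WeierstrassCurve ℤ).b₆⟩ : WeierstrassCurve ℤ) =
      ⟨0, -764, 0, 0, -111485936⟩ := by
  ext <;> decide +kernel

/-- Killers for the twist model `⟨0, -764, 0, 0, -111485936⟩` of `E^{(-191)}` from the kernel counts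
`(q, #Ṽ(𝔽_q)) ∈ [(3, 6), (13, 19)]`. [cite: SilvermanAEC2009, Prop. VII.3.1(b)] -/
theorem killers_neg191 : ∀ ℓN ∈ [((3 : ℕ), (6 : ℕ)), (13, 19)], ℓN.1.Prime ∧
    ∀ (x : ((⟨0, -764, 0, 0, -111485936⟩ : WeierstrassCurve ℤ).map (Int.castRingHom ℚ)).toAffine.Point)
      (n : ℕ), ¬ ℓN.1 ∣ n → n • x = 0 → ℓN.2 • x = 0 :=
  killers_cons _ (q := 3) (N := 6) (by decide +kernel) (by decide +kernel)
    (killers_cons _ (q := 13) (N := 19) (by decide +kernel) (by decide +kernel)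
    (killers_nil _))

/-- **`2 ≤ rank_ℤ E^{(-191)}(ℚ)` for `E = 43a1` IN THE KERNEL**, on the twist model `⟨0, -764, 0, 0, -111485936⟩`: rational
kernel certificate `Rank2Observatory.two_le_mordellWeilRank_of_ratCert` with the points
`P₁ = (3056, -145924)`, `P₂ = (591336/289, -356200484/4913)` (found by a naive search on `d·η² = f(x)`), their chord
`P₁ + P₂ = (948, -7340)`, odd torsion annihilator `t = 1` from the counts at `q = 3, 13`, and doubling
witnesses at `q = 5, 3, 3` (residues `(1,1)`, `(0,2)`, `(0,1)`). Hence `P₁, P₂` are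
`ℤ`-independent. [cite: SilvermanAEC2009, III.2.3, Prop. VII.3.1(b) and Thm. VIII.6.7]
[cite: CremonaAlgorithms1997, §3.5] -/
theorem two_le_rank_twist_neg191 :
    2 ≤ ((⟨0, -764, 0, 0, -111485936⟩ : WeierstrassCurve ℤ).map (Int.castRingHom ℚ)).mordellWeilRank :=
  two_le_mordellWeilRank_of_ratCert _ (x₁ := 3056) (y₁ := -145924) (x₂ := 591336/289) (y₂ := -356200484/4913)
    (x₃ := 948) (y₃ := -7340) (by decide +kernel) (by decide +kernel)
    (by decide +kernel) (by decide +kernel) (t := 1) (by decide) killers_neg191 (by decide +kernel)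
    5 3 3 (by decide +kernel) (by decide +kernel) (by decide +kernel) (by decide +kernel)
    (by decide +kernel) (by decide +kernel) 1 1 0 2 0 1 (by decide +kernel)
    (by decide +kernel) (by decide +kernel) (by decide +kernel) (by decide +kernel)
    (by decide +kernel)

/-- **SECOND-SIGN DEPTH-TABLE ROW `43a1`, `(p, d_K, ℓ) = (5, -191, 179)`, ON PRINT-STANDARD INPUTS.**
For `E = 43a1` (rank one), ANY imaginary quadratic `K` with `d_K = -191` (Heegner for `N_E`; the twist
`E^{(-191)}` has two independent rational points, certified in the kernel), any frame `(Dt, β, ι)` and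
ANY single Kolyvagin–Heegner datum `d` of conductor `179` (a Kolyvagin prime: `(-191/179) = −1`,
`5 ∣ 179 + 1`, `5 ∣ a_179 = 20`), granted the ONE Literature fact (γ) =
`GrossLMS1991.prop37_2_frobeniusCongruence` (Gross 1991 Prop. 3.7 (2); cite-only): IF
`d.kolyvaginClass _ 1 ≠ 0` (the row's bit), THEN `corank_{ℤ_5} Ш(E)[5^∞] = 0`, `rank_ℤ E(ℚ) = 1`,
`corank_{ℤ_5} Ш(E^{(-191)})[5^∞] = 0`, `rank_ℤ E^{(-191)}(ℚ) = 2`, `E(ℚ)[5] = 0`, `Ш(E/ℚ)[5] = 0`,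
`#Sel^(5)(E/ℚ) = 5`, `Ш(E^{(-191)}/ℚ)[5] = 0` and `#Sel^(5)(E^{(-191)}/ℚ) = 5²` — the crux's SECOND
rank clause `ν = rank E(ℚ) = rank E^{(d_K)}(ℚ) − 1` at this curve, and `Ш[5] = 0` for the RANK-TWO
curve `E^{(-191)}` (conductor `N_E·191²`), which no first-sign row reaches through `K`. Side conditions:
`ρ̄_{E,5^m}` onto (`hasSurjectiveModNGaloisRep_pow_5`), non-CM, Heegner, Kolyvagin prime
(`card_179`), (KN_5) from `Δ(E₀) = -43` (`decide`-able table), `1 ≤ rank` (`one_le_rank`),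
`2 ≤ rank E^{(-191)}` (`two_le_rank_twist_neg191`) — all kernel theorems. CONDITIONAL on (γ) and the
bit; per-curve; BSD is not proved by it. [cite: Kolyvagin1991MathAnn, Thm. 2.3]
[cite: GrossLMS1991, Prop. 3.7 (2), §5 (5.1), Prop. 6.2 (1)] [cite: McCallumLMS1991, §§2–5]
[cite: JetchevLauterStein2009, §3.6 (arXiv:0707.0032)] -/
theorem depthRow_5_neg191_179_secondSign
    (h372 : GrossLMS1991.prop37_2_frobeniusCongruence)
    (K : Type) [Field K] [NumberField K] (hK : IsImaginaryQuadratic K)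
    (hD : NumberField.discr K = -191) :
    haveI := isElliptic;
    haveI := isGloballyMinimal;
    haveI : NeZero (((⟨0, 1, 1, 0, 0⟩ : WeierstrassCurve ℤ).map (Int.castRingHom ℚ)).conductorNorm ℤ) := neZero_conductorNorm_of_isElliptic _;
    ∀ (Dt : ModularParametrizationData ((⟨0, 1, 1, 0, 0⟩ : WeierstrassCurve ℤ).map (Int.castRingHom ℚ)) (((⟨0, 1, 1, 0, 0⟩ : WeierstrassCurve ℤ).map (Int.castRingHom ℚ)).conductorNorm ℤ)) (β : ℤ) (ι : K →+* ℂ)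
      (d : KolyvaginHeegnerData Dt β ι 179),
    d.kolyvaginClass (p := 5) (by norm_num) 1 ≠ 0 →
    ((⟨0, 1, 1, 0, 0⟩ : WeierstrassCurve ℤ).map (Int.castRingHom ℚ)).shaCorank 5 = 0 ∧ ((⟨0, 1, 1, 0, 0⟩ : WeierstrassCurve ℤ).map (Int.castRingHom ℚ)).mordellWeilRank = 1 ∧
      (((⟨0, 1, 1, 0, 0⟩ : WeierstrassCurve ℤ).map (Int.castRingHom ℚ)).quadraticTwist ((-191 : ℤ) : ℚ)).shaCorank 5 = 0 ∧
      (((⟨0, 1, 1, 0, 0⟩ : WeierstrassCurve ℤ).map (Int.castRingHom ℚ)).quadraticTwist ((-191 : ℤ) : ℚ)).mordellWeilRank = 2 ∧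
      (∀ P : ((⟨0, 1, 1, 0, 0⟩ : WeierstrassCurve ℤ).map (Int.castRingHom ℚ)).toAffine.Point, 5 • P = 0 → P = 0) ∧
      (∀ x ∈ ((⟨0, 1, 1, 0, 0⟩ : WeierstrassCurve ℤ).map (Int.castRingHom ℚ)).sha, 5 • x = 0 → x = 0) ∧
      Nat.card ↥(selmerGroup ((⟨0, 1, 1, 0, 0⟩ : WeierstrassCurve ℤ).map (Int.castRingHom ℚ)) ((5 : ℕ) : ℤ)) = 5 ∧
      (∀ x ∈ (((⟨0, 1, 1, 0, 0⟩ : WeierstrassCurve ℤ).map (Int.castRingHom ℚ)).quadraticTwist ((-191 : ℤ) : ℚ)).sha, 5 • x = 0 → x = 0) ∧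
      Nat.card ↥(selmerGroup (((⟨0, 1, 1, 0, 0⟩ : WeierstrassCurve ℤ).map (Int.castRingHom ℚ)).quadraticTwist ((-191 : ℤ) : ℚ)) ((5 : ℕ) : ℤ)) = 5 ^ 2 := by
  haveI := isElliptic
  haveI := isGloballyMinimal
  haveI : NeZero (((⟨0, 1, 1, 0, 0⟩ : WeierstrassCurve ℤ).map (Int.castRingHom ℚ)).conductorNorm ℤ) := neZero_conductorNorm_of_isElliptic _
  intro Dt β ι d hne
  haveI := Fact.mk (by norm_num : Nat.Prime 5)
  exact depthRowSecondSign_print_of_datum_of_intModel_certificate intModel h372 not_hasCM one_le_rank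
    5 (by norm_num) hasSurjectiveModNGaloisRep_pow_5 K hK hD (by norm_num) (by norm_num)
    twistModel_neg191 two_le_rank_twist_neg191 heegner_neg191 179 (by norm_num) (by norm_num)
    (by decide +kernel) (by norm_num) (by norm_num) (by norm_num) (by norm_num) (n := 160) card_179
    (by norm_num) (Δ₀ := -43) (by decide +kernel) (B := 11) (by decide +kernel) (by decide +kernel)
    (fun _ _ ↦ Or.inl (by norm_num)) Dt β ι d hne

end C43a1


end SecondSign

end Summit.BirchSwinnertonDyer.BirchSwinnertonDyer.Theorems.KolyvaginDepthDoor

end
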